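import Summits.Ventures.HSemireg.S4BridgeSplitPointHodge
import Summits.HodgeConjecture.HodgeConjecture.Theorems.Ring2AbelianAllNonsplitNormObstruction
import HarnessLib

/-!
# Venture HSemireg — S4-PUSH bridge (B2) at NAMED NON-SPLIT components: the product-point anchors of the cell's
# `ℚ(√-3)` rows — `(3, ℚ(√-3), [-2])` (TARGET-TABLE R1, g = 6), `(5, ℚ(√-3), [-2])`, and the S4 rung `(6, ℚ(√-3), [2])`

HONEST FRAMING. Bridge-typing file of the computation cell `pub-hsemireg` (track «S4-PUSH» (iii), seat s4-bridge-2;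
companion of `S4BridgeSplitPoint.lean` / `S4BridgeSplitPointHodge.lean`). THEOREMS ONLY (0 sorry, no definition, no named
fact consumed). It instantiates (B2) where the S4 protocol (S4-PLAN §2 (P1): «an object COUNTS only … on a NAMED NON-SPLIT
component `(η, h, a)`, `a ∉ (-1)ⁿ·Nm(K^×)`») wants anchors: for every NON-SPLIT class and, by name, for the three
`ℚ(√-3)` cells the cell's tables carry, the component contains a PRODUCT POINT over one CM curve `E₀` (`ψ₀ ≫ ψ₀ = -3`)
whose `K`-symmetrised hyperplane class has the named class, is NOT hyperbolic (so the point is not of split Weil type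
for that polarisation — referee trap (i)), and at which the Hodge conjecture HOLDS (Tate). The arithmetic input «`2` is
not a norm from `ℚ(√-3)`» (`x² + 3y² = 2` has no rational solution) is ring 2's tree theorem
`Ring2AbelianAll.NonsplitNormObstruction.two_ne_splitDiscriminantClass_of_even` / `negTwo_ne_splitDiscriminantClass_of_odd`
(cell G3-COVERAGE §3: «K = ℚ(√-3): λ ∈ {1,3,4,7,9,12} norms, {2,5,6,8,10,11} not»). Nothing here bears on any OPEN case of
the Hodge conjecture; no object of the cell is certified (an anchor is a POINT, not a semiregular object); HC / HC_CM /
HC_AV are NOT proved. ROW WORDING (referee precision P-2): «HC at the anchor» quoted outside the cell always carries «(Tate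
1965 — products of copies of one CM curve; no open case touched)», and an anchor row never counts toward the (P1) object
census (the anchors give WHERE and what is free there; the census stays candidates 0 · objects 0 until an object of record
exists).

AS PRINTED / derived: the product point and its class — [vanGeemen2022WeilDecomposable] §7.3 (`n = 2`), [vanGeemen1994HodgeAV]
4.14, 5.3–5.8 (all `n`, index set), tree theorem `splitPointInEachDiscriminantComponent_holds`; non-split ⟺ `δ ≠ [(-1)ⁿ]`
— [vanGeemen1994HodgeAV] 5.4 (5.4.1) (Landherr), [Markman2025SurveySecant] §11.5 Step 1 (p. 21) «the coset of `(-1)ⁿ` if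
and only if … split Weil type»; HC at the point — [vanGeemen1994HodgeAV] Thm. 4.3 (Tate); the cell's rows — `target-g6/TARGET-TABLE.md`
§0/§1 (R1 = `(3, ℚ(√-3), a ≡ 2)`), `general-structure/STRUCTURE.md` §3.1 («on a NON-SPLIT component (a ∉ Nm K^×; at g = 6 e.g.
`(3, ℚ(√-3), a ≡ 2)`) it is NEW»), S4-PLAN §2 (P1) (the rung `n = 6`: `a ∉ Nm(K^×)`).

* `exists_cmProductPoint_nonsplit` — every NON-SPLIT inhabited component `(n, d, δ)` (`sign δ = (-1)ⁿ`, `δ ≠ [(-1)ⁿ]`)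
  contains a product point over one CM curve, of Weil type `(n, d)`, with `h_K` of class `δ`, `h_K` NOT hyperbolic, and
  `HodgeConjectureFor A.dim A.X`.
* `rungThree_sqrtNegThree_negTwo`, `rungFive_sqrtNegThree_negTwo`, `rungSix_sqrtNegThree_two` — the three named cells.
-/

noncomputable section

open CategoryTheory
open Literature.AlgebraicGeometry Literature.AlgebraicGeometry.Motives
open Literature.AlgebraicGeometry.HodgeTheory
open Literature.AlgebraicGeometry.VanGeemen1994
open Literature.AlgebraicTopology.SingularHomology
open Summit.HodgeConjecture.HodgeConjecture.Ring2.Hypotheses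
open Summit.HodgeConjecture.HodgeConjecture.Ring2.AbelianAll
open Summit.HodgeConjecture.Ring2AbelianAll.NonsplitNormObstruction

namespace Summit.Ventures.HSemireg

/-! ### §1 Every non-split component has a non-hyperbolic product-point anchor at which HC holds -/

/-- **(B2) on a NAMED NON-SPLIT component.** For `n ≥ 1`, `d ≥ 1` and a class `δ` with `sign δ = (-1)ⁿ` and
`δ ≠ [(-1)ⁿ]` (non-split; van Geemen (5.4.1) / Markman §11.5 Step 1): the component `(n, d, δ)` contains a product
point `(A, φ, h_K)` over one CM curve `(E₀, ψ₀)` — of Weil type `(n, d)`, `h_K = d·e^*a + φ^*e^*a` of non-degenerate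
class `δ` — such that `h_K` is NOT hyperbolic (the point is not of split Weil type for this polarisation) and the Hodge
conjecture holds on `A` (Tate). Assembly of `exists_cmProductPoint_hodgeConjectureFor` and
`VanGeemen1994.not_isHyperbolicWeilType_of_hasWeilDiscriminantNondeg_ne`. [cite: vanGeemen1994HodgeAV, Thm. 4.3, 4.14 and 5.4 (5.4.1)]
[cite: Markman2025SurveySecant, §11.5 Step 1 (p. 21)] [cite: vanGeemen2022WeilDecomposable, §7.3] -/
theorem exists_cmProductPoint_nonsplit {n d : ℕ} (hn : 0 < n) (hd : 0 < d) {δ : weilNormResidueGroup d}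
    (hδ : weilSign d δ = (-1) ^ n) (hne : δ ≠ splitDiscriminantClass n d) :
    ∃ (E₀ : AbelianVariety ℂ) (ψ₀ : E₀ ⟶ E₀) (A : AbelianVariety ℂ) (φ : A ⟶ A)
      (e : ProjectiveEmbedding A.X) (a : complexBetti (projectiveSpace e.n ℂ) 2),
      E₀.dim = 1 ∧ ψ₀ ≫ ψ₀ = -(d • 𝟙 E₀) ∧ IsCMProductPoint E₀ ψ₀ A φ ∧ IsWeilType A φ n d ∧
        IsRationalClass a ∧ a ≠ 0 ∧
        HasWeilDiscriminantNondeg A φ n d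
          ((d : ℂ) • complexBetti.map e.ι 2 a + complexBetti.map φ.hom.hom.hom 2 (complexBetti.map e.ι 2 a)) δ ∧
        ¬ IsHyperbolicWeilType A φ n
          ((d : ℂ) • complexBetti.map e.ι 2 a + complexBetti.map φ.hom.hom.hom 2 (complexBetti.map e.ι 2 a)) ∧
        HodgeConjectureFor A.dim A.X := by
  obtain ⟨E₀, ψ₀, A, φ, e, a, hE, hψ, hP, hW, ha, ha0, hN, hHC⟩ := exists_cmProductPoint_hodgeConjectureFor hn hd hδ
  exact ⟨E₀, ψ₀, A, φ, e, a, hE, hψ, hP, hW, ha, ha0, hN,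
    not_isHyperbolicWeilType_of_hasWeilDiscriminantNondeg_ne hW.pos hW.dim_eq hW.d_pos hW.sq_eq e ha ha0 hN hne, hHC⟩

/-! ### §2 The named `ℚ(√-3)` cells of the cell's tables -/

/-- `sign [-2] = -1 = (-1)³ = (-1)⁵` and `sign [2] = 1 = (-1)⁶` in `ℚˣ/Nm(ℚ(√-3)ˣ)`: the three named cells have the
right sign. [cite: vanGeemen1994HodgeAV, 4.14] -/
theorem weilSign_negTwo_three :
    weilSign 3 (QuotientGroup.mk (Units.mk0 (-2 : ℚ) (by norm_num)) : weilNormResidueGroup 3) = -1 :=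
  weilSign_mk_of_neg 3 (by simp)

/-- `sign [2] = 1` in `ℚˣ/Nm(ℚ(√-3)ˣ)`. [cite: vanGeemen1994HodgeAV, 4.14] -/
theorem weilSign_two_three :
    weilSign 3 (QuotientGroup.mk (Units.mk0 (2 : ℚ) two_ne_zero) : weilNormResidueGroup 3) = 1 :=
  weilSign_mk_of_pos 3 (by simp)

/-- **R1 at `g = 6`: the non-split sixfold component `(3, ℚ(√-3), [-2])`** (the cell's deciding row R1, `a ≡ 2`,
`δ = (-1)³·a = -2`; STRUCTURE §3.1 «at g = 6 e.g. `(3, ℚ(√-3), a ≡ 2)` it is NEW») contains a product point over one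
CM curve `E₀` (`ψ₀ ≫ ψ₀ = -3`), of Weil type `(3, 3)`, `h_K` of class `[-2]` and NOT hyperbolic, with HC at the point
(Tate 1965 — products of copies of one CM curve; no open case touched). `[-2] ≠ [-1]` is ring 2's
`negTwo_ne_splitDiscriminantClass_of_odd` (`2 ∉ Nm ℚ(√-3)ˣ`). THE LEAN WITNESS is the point that
`exists_cmProduct_member` constructs (the CM tower `(E₀ × E₀)³` over `E₀ = ℂ/(ℤ + ℤ√-3)`, `K` acting factorwise by
`±[√-3]`, weighted Segre polarisation), reached through `exists_cmProductPoint_nonsplit`; the identification with the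
cell's «`E_ω³ × Ē_ω³`-type anchor with weights of product `2`, up to isogeny and the order of the factors» is the
EXPECTED SHAPE in prose — NO isogeny statement is typed or proved in this file (referee precision P-1,
`s4push/VERDICT-B2-HODGE-RUNGS-2026-08-23.md`): a table row may cite this theorem for the product point, its class and
HC at it, not for an `E_ω³ × Ē_ω³` identification. [cite: vanGeemen1994HodgeAV, Thm. 4.3 and 5.4 (5.4.1)]
[cite: Markman2025SurveySecant, §11.5 Step 1 (p. 21)] -/
theorem rungThree_sqrtNegThree_negTwo :
    ∃ (E₀ : AbelianVariety ℂ) (ψ₀ : E₀ ⟶ E₀) (A : AbelianVariety ℂ) (φ : A ⟶ A)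
      (e : ProjectiveEmbedding A.X) (a : complexBetti (projectiveSpace e.n ℂ) 2),
      E₀.dim = 1 ∧ ψ₀ ≫ ψ₀ = -((3 : ℕ) • 𝟙 E₀) ∧ IsCMProductPoint E₀ ψ₀ A φ ∧ IsWeilType A φ 3 3 ∧
        IsRationalClass a ∧ a ≠ 0 ∧
        HasWeilDiscriminantNondeg A φ 3 3
          (((3 : ℕ) : ℂ) • complexBetti.map e.ι 2 a + complexBetti.map φ.hom.hom.hom 2 (complexBetti.map e.ι 2 a))
          (QuotientGroup.mk (Units.mk0 (-2 : ℚ) (by norm_num))) ∧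
        ¬ IsHyperbolicWeilType A φ 3
          (((3 : ℕ) : ℂ) • complexBetti.map e.ι 2 a + complexBetti.map φ.hom.hom.hom 2 (complexBetti.map e.ι 2 a)) ∧
        HodgeConjectureFor A.dim A.X :=
  exists_cmProductPoint_nonsplit (by norm_num) (by norm_num)
    (by rw [weilSign_negTwo_three]; exact (show ((-1 : ℤˣ) ^ (3 : ℕ)) = -1 from by decide).symm)
    (negTwo_ne_splitDiscriminantClass_of_odd (by decide))

/-- **The `n = 5` rung, same field and class: `(5, ℚ(√-3), [-2])`** (Weil tenfolds; non-split) contains a product point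
over one CM curve with `h_K` of class `[-2]`, not hyperbolic, HC at the point. [cite: vanGeemen1994HodgeAV, Thm. 4.3 and 5.4 (5.4.1)]
[cite: Markman2025SurveySecant, §11.5 Step 1 (p. 21)] -/
theorem rungFive_sqrtNegThree_negTwo :
    ∃ (E₀ : AbelianVariety ℂ) (ψ₀ : E₀ ⟶ E₀) (A : AbelianVariety ℂ) (φ : A ⟶ A)
      (e : ProjectiveEmbedding A.X) (a : complexBetti (projectiveSpace e.n ℂ) 2),
      E₀.dim = 1 ∧ ψ₀ ≫ ψ₀ = -((3 : ℕ) • 𝟙 E₀) ∧ IsCMProductPoint E₀ ψ₀ A φ ∧ IsWeilType A φ 5 3 ∧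
        IsRationalClass a ∧ a ≠ 0 ∧
        HasWeilDiscriminantNondeg A φ 5 3
          (((3 : ℕ) : ℂ) • complexBetti.map e.ι 2 a + complexBetti.map φ.hom.hom.hom 2 (complexBetti.map e.ι 2 a))
          (QuotientGroup.mk (Units.mk0 (-2 : ℚ) (by norm_num))) ∧
        ¬ IsHyperbolicWeilType A φ 5
          (((3 : ℕ) : ℂ) • complexBetti.map e.ι 2 a + complexBetti.map φ.hom.hom.hom 2 (complexBetti.map e.ι 2 a)) ∧
        HodgeConjectureFor A.dim A.X :=
  exists_cmProductPoint_nonsplit (by norm_num) (by norm_num)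
    (by rw [weilSign_negTwo_three]; exact (show ((-1 : ℤˣ) ^ (5 : ℕ)) = -1 from by decide).symm)
    (negTwo_ne_splitDiscriminantClass_of_odd (by decide))

/-- **The S4 rung `n = 6`: the non-split twelvefold component `(6, ℚ(√-3), [2])`** (S4-PLAN §2 (P1): at `n = 6` non-split
reads `a ∉ Nm(K^×)`; `2 ∉ Nm ℚ(√-3)ˣ`, ring 2's `two_ne_splitDiscriminantClass_of_even`) contains a product point over
one CM curve `E₀` (`ψ₀ ≫ ψ₀ = -3`), of Weil type `(6, 3)`, `h_K` of class `[2]` and NOT hyperbolic, with the Hodge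
conjecture at the point (Tate) — an ANCHOR POINT for rung rows placed directly on this component (S4-R1′), not an object.
[cite: vanGeemen1994HodgeAV, Thm. 4.3 and 5.4 (5.4.1)] [cite: Markman2025SurveySecant, §11.5 Step 1 (p. 21)]
[cite: vanGeemen2022WeilDecomposable, §7.3] -/
theorem rungSix_sqrtNegThree_two :
    ∃ (E₀ : AbelianVariety ℂ) (ψ₀ : E₀ ⟶ E₀) (A : AbelianVariety ℂ) (φ : A ⟶ A)
      (e : ProjectiveEmbedding A.X) (a : complexBetti (projectiveSpace e.n ℂ) 2),
      E₀.dim = 1 ∧ ψ₀ ≫ ψ₀ = -((3 : ℕ) • 𝟙 E₀) ∧ IsCMProductPoint E₀ ψ₀ A φ ∧ IsWeilType A φ 6 3 ∧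
        IsRationalClass a ∧ a ≠ 0 ∧
        HasWeilDiscriminantNondeg A φ 6 3
          (((3 : ℕ) : ℂ) • complexBetti.map e.ι 2 a + complexBetti.map φ.hom.hom.hom 2 (complexBetti.map e.ι 2 a))
          (QuotientGroup.mk (Units.mk0 (2 : ℚ) two_ne_zero)) ∧
        ¬ IsHyperbolicWeilType A φ 6
          (((3 : ℕ) : ℂ) • complexBetti.map e.ι 2 a + complexBetti.map φ.hom.hom.hom 2 (complexBetti.map e.ι 2 a)) ∧
        HodgeConjectureFor A.dim A.X :=
  exists_cmProductPoint_nonsplit (by norm_num) (by norm_num)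
    (by rw [weilSign_two_three]; exact (show ((-1 : ℤˣ) ^ (6 : ℕ)) = 1 from by decide).symm)
    (two_ne_splitDiscriminantClass_of_even (by decide))

end Summit.Ventures.HSemireg

end
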